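import Summits.BirchSwinnertonDyer.Rank1Residual.Additive.ThreeAdicLift
import Summits.BirchSwinnertonDyer.Rank1Residual.Additive.CyclotomicThreeReduction
import Summits.BirchSwinnertonDyer.Rank1Residual.Additive.SemistabilityDefectRamification
import Literature.NumberTheory.EllipticCurves.SelmerFiniteProofs
import Mathlib.NumberTheory.RamificationInertia.Valuation
import HarnessLib

/-!
# Additive classes X3/X4 at `p = 3`: the `3`-adic data of a good model of `E` over `ℚ(ζ₃)`
# (Tate's algorithm for tame `I₀*`, step 2)

HONEST FRAMING (cell `b2b-bsdres`, run/shared/lean/b2b/bsd-rank1-residual/, verbatim in every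
file): the goal of the cell is to DELETE the COMBINATION-SHAPED residual classes of the
Birch–Swinnerton-Dyer formula for ALL analytic-rank `≤ 1` elliptic curves over `ℚ` — "full BSD
formula for every rank `≤ 1` curve in class `C`" assembled STRICTLY from published theorems — so
that the rank-`≤ 1` remainder becomes exactly the CONSTRUCTION-SHAPED classes, which are TYPED
(missing-input `Prop`s), NOT attempted. This is not "finishing BSD". Sub-cell `additive-p2`
(CLASS-OWNERS row "X3/X4 additive — pot. good ordinary / X3♯(G-ord)"), generation 7: research
route; no claim beyond the stated classes; theorems only, no definition, no named fact;
X3♯(G-ord)/X4♯(G-ord) stay CONSTRUCTION-SHAPED.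

WHAT THIS FILE DOES (input to `TypeGThree.lean`, which proves `TypeG W 3 ∧ Addv W 3 ⇒ E^{(−3)}`
good at `3` — the `p = 3` twist datum of the class theorems — by Tate's algorithm, with NO
Néron–Ogg–Shafarevich input). Let `K = ℚ(ζ₃)` (`IsCyclotomicExtension {3} ℚ K`), `𝔓` its place
above `3` (`e(𝔓|3) = 2`, `f = 1`), `W/ℚ` globally minimal, and suppose `E_K` has GOOD reduction at
`𝔓`. Then (`exists_rat_of_hasGoodReductionAt_baseChange_three`) with `6k = ord₃ Δ_min(E)` there is
a RATIONAL, `3`-integral `ρ` with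
`ord₃(b₂ + 12ρ) ≥ k`, `ord₃(b₄ + ρb₂ + 6ρ²) ≥ 2k`, `ord₃(b₆ + 2ρb₄ + ρ²b₂ + 4ρ³) ≥ 3k`
(stated with Mathlib's `Rat.padicValuation 3`, `≤ exp(−k)` etc.). Steps:
* `exists_int_valued_sub_lt_one` — every `𝔓`-adic integer of `K_𝔓` is congruent to `0, 1` or `−1`
  (`N(𝔓) = 3`: `exists_prime_over_three`, `natCard_residueField_adicCompletionIntegers_eq_three`;
  `ȳ³ = ȳ` by `FiniteField.pow_card`, and `𝔪` is prime);
* `valued_algebraMap_rat_eq_sq` — on `ℚ ⊂ K_𝔓` the valuation is the SQUARE of the `3`-adic one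
  (Mathlib `IsCyclotomicExtension.Rat.ramificationIdx_eq_of_prime`, `valuation_liesOver`);
* the good `𝒪_𝔓`-model `(u, r, s, t) • W` (tree `exists_integralModel_of_hasGoodReductionAt`) has
  integral `b`-invariants `u⁻²(b₂ + 12r)`, `u⁻⁴(b₄ + rb₂ + 6r²)`, `u⁻⁶(b₆ + 2rb₄ + r²b₂ + 4r³)`
  (Mathlib `variableChange_b₂/b₄/b₆`) and `v(u)¹² = v(Δ_W) = v₃(Δ_W)²`, so `v(u) = exp(−k)`;
* the `3`-adic lift `ThreeAdicLift.exists_rat_of_integrality` (gen 7, sibling file) replaces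
  `r ∈ K_𝔓` by a rational `ρ`.
Also the `3`-adic readings at the place `u ∋ 3` of `𝓞 ℚ` used downstream
(`valuation_le_one_iff_padicValuation_three`, `valuation_eq_one_iff_padicValuation_three`,
`padicValuation_three_div_le_one`, `padicValuation_three_div_eq_one`).

References: J. Tate, "Algorithm for determining the type of a singular fiber in an elliptic
pencil", Antwerp IV, LNM 476 (1975) §§7–8; J. H. Silverman, *AEC* III.1 Table 3.1, VII.1, VII.5.1;
L. Washington, *Cyclotomic Fields*, Lemma 1.4 (`3` totally ramified in `ℚ(ζ₃)`).
-/

noncomputable section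

open scoped Classical NumberField

open WeierstrassCurve IsDedekindDomain IsDedekindDomain.HeightOneSpectrum NumberField IsLocalRing
  WithZero Literature.NumberTheory.EllipticCurves Literature.NumberTheory.EllipticCurves.Rank1Residual

namespace Summit.BirchSwinnertonDyer.Rank1Residual.Additive

/-! ### The residue field of `K_𝔓`, `K = ℚ(ζ₃)`, `𝔓 ∣ 3`, is the prime field `𝔽₃` -/

section Residue

variable {K : Type} [Field K] [NumberField K] [IsCyclotomicExtension {3} ℚ K]

/-- **Every `𝔓`-adic integer of `ℚ(ζ₃)_𝔓` (`𝔓 ∣ 3`) is congruent to `0`, `1` or `−1`**: the residue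
field of the completion has `N(𝔓) = 3` elements (`3` is totally ramified in `ℚ(ζ₃)`,
`exists_prime_over_three`, `natCard_residueField_adicCompletionIntegers_eq_three`), so `ȳ³ = ȳ`
(`FiniteField.pow_card`), i.e. `y(y − 1)(y + 1) ∈ 𝔪`, and `𝔪` is prime. [folklore] -/
theorem exists_int_valued_sub_lt_one (𝔓 : HeightOneSpectrum (𝓞 K))
    (h3 : ((3 : ℕ) : 𝓞 K) ∈ 𝔓.asIdeal) (x : 𝔓.adicCompletion K) (hx : Valued.v x ≤ 1) :
    ∃ c : ℤ, Valued.v (x - (c : 𝔓.adicCompletion K)) < 1 := by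
  obtain ⟨𝔭, -, h𝔭uniq, h𝔭N⟩ := exists_prime_over_three K
  have h𝔓𝔭 : 𝔓 = 𝔭 := by
    have h : 𝔓 ∈ {v : HeightOneSpectrum (𝓞 K) | ((3 : ℕ) : 𝓞 K) ∈ v.asIdeal} := h3
    rw [h𝔭uniq] at h
    exact h
  have hN : Ideal.absNorm 𝔓.asIdeal = 3 := by rw [h𝔓𝔭]; exact h𝔭N
  set R := 𝔓.adicCompletionIntegers K with hR
  have hk : Nat.card (ResidueField R) = 3 := natCard_residueField_adicCompletionIntegers_eq_three 𝔓 hN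
  haveI : Finite (ResidueField R) := Nat.finite_of_card_ne_zero (by rw [hk]; norm_num)
  letI : Fintype (ResidueField R) := Fintype.ofFinite _
  have hcard : Fintype.card (ResidueField R) = 3 := by rw [Fintype.card_eq_nat_card, hk]
  let y : R := ⟨x, (mem_adicCompletionIntegers (𝓞 K) K 𝔓).mpr hx⟩
  have hy : (y : 𝔓.adicCompletion K) = x := rfl
  have hpow : residue R y ^ 3 = residue R y := by rw [← hcard]; exact FiniteField.pow_card _
  have hmem : y * (y - 1) * (y + 1) ∈ maximalIdeal R := by
    rw [← residue_eq_zero_iff, show y * (y - 1) * (y + 1) = y ^ 3 - y by ring, map_sub, map_pow,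
      hpow, sub_self]
  have key : ∀ z : R, z ∈ maximalIdeal R → Valued.v (z : 𝔓.adicCompletion K) < 1 := fun z hz ↦
    Valuation.Integer.not_isUnit_iff_valuation_lt_one.mp ((IsLocalRing.mem_maximalIdeal z).mp hz)
  rcases (Ideal.IsPrime.mem_or_mem inferInstance hmem) with h | h
  · rcases (Ideal.IsPrime.mem_or_mem inferInstance h) with h' | h'
    · exact ⟨0, by simpa [hy] using key y h'⟩
    · refine ⟨1, ?_⟩
      have := key _ h'
      simpa [hy] using this
  · refine ⟨-1, ?_⟩
    have := key _ h
    simpa [hy, sub_neg_eq_add] using this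

end Residue

/-! ### Extraction: the `3`-adic data of a good model of `E_K` above `3`, `K = ℚ(ζ₃)` -/

section Extraction

variable {K : Type} [Field K] [NumberField K] [IsCyclotomicExtension {3} ℚ K]
  (W : WeierstrassCurve ℚ) [W.IsElliptic] [W.IsGloballyMinimal]

omit [IsCyclotomicExtension {3} ℚ K] [W.IsElliptic] [W.IsGloballyMinimal] in
/-- In a valued field, `v(u⁻¹ⁿ · B) ≤ 1` gives `v(B) ≤ v(u)ⁿ` (`u ≠ 0`). [folklore] -/
theorem valuation_le_pow_of_inv_pow_mul_le_one {L : Type*} [Field L]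
    (v : Valuation L ℤᵐ⁰) {u B : L} (hu : u ≠ 0) {n : ℕ} (h : v (u⁻¹ ^ n * B) ≤ 1) :
    v B ≤ v u ^ n := by
  have hB : B = u ^ n * (u⁻¹ ^ n * B) := by
    rw [← mul_assoc, ← mul_pow, mul_inv_cancel₀ hu, one_pow, one_mul]
  calc v B = v u ^ n * v (u⁻¹ ^ n * B) := by rw [hB, map_mul, map_pow, ← hB]
    _ ≤ v u ^ n * 1 := mul_le_mul' le_rfl h
    _ = v u ^ n := mul_one _

omit [W.IsElliptic] [W.IsGloballyMinimal] in
/-- The `b`-invariants of a globally minimal `W/ℚ` are `3`-adically integral (they are integers: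
`integralModelInt`). [folklore] -/
theorem padicValuation_b_le_one [W.IsGloballyMinimal] :
    Rat.padicValuation 3 W.b₂ ≤ 1 ∧ Rat.padicValuation 3 W.b₄ ≤ 1 ∧ Rat.padicValuation 3 W.b₆ ≤ 1 := by
  have h := map_integralModelInt W
  have h₂ : W.b₂ = ((integralModelInt W).b₂ : ℚ) := by
    conv_lhs => rw [← h]
    rw [map_b₂, eq_intCast]
  have h₄ : W.b₄ = ((integralModelInt W).b₄ : ℚ) := by
    conv_lhs => rw [← h]
    rw [map_b₄, eq_intCast]
  have h₆ : W.b₆ = ((integralModelInt W).b₆ : ℚ) := by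
    conv_lhs => rw [← h]
    rw [map_b₆, eq_intCast]
  refine ⟨?_, ?_, ?_⟩
  · rw [h₂, Rat.padicValuation_cast]; exact Int.padicValuation_le_one 3 _
  · rw [h₄, Rat.padicValuation_cast]; exact Int.padicValuation_le_one 3 _
  · rw [h₆, Rat.padicValuation_cast]; exact Int.padicValuation_le_one 3 _

omit [W.IsElliptic] [W.IsGloballyMinimal] in
/-- `ord₃`-reading of Mathlib's `3`-adic valuation on `ℚ`: `v₃(x) = exp(−ord₃ x)` (`x ≠ 0`). [folklore] -/
theorem padicValuation_three_apply {x : ℚ} (hx : x ≠ 0) :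
    Rat.padicValuation 3 x = exp (-padicValRat 3 x) := by
  simp [Rat.padicValuation, hx]

/-- **The valuation of `K_𝔓` restricted to `ℚ` is the SQUARE of the `3`-adic valuation**
(`K = ℚ(ζ₃)`, `𝔓 ∣ 3`, `e(𝔓|3) = 2`: Mathlib `IsCyclotomicExtension.Rat.ramificationIdx_eq_of_prime`,
`valuation_liesOver`, `valuedAdicCompletion_eq_valuation'`). [folklore] -/
theorem valued_algebraMap_rat_eq_sq (𝔓 : HeightOneSpectrum (𝓞 K)) (h3 : ((3 : ℕ) : 𝓞 K) ∈ 𝔓.asIdeal)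
    (q : ℚ) :
    Valued.v (algebraMap K (𝔓.adicCompletion K) (algebraMap ℚ K q)) = Rat.padicValuation 3 q ^ 2 := by
  -- the place of `ℤ` below `𝔓` is `(3)`
  set v : HeightOneSpectrum ℤ := (Rat.HeightOneSpectrum.primesEquiv (R := ℤ)).symm ⟨3, Nat.prime_three⟩
    with hvdef
  have hv : Rat.HeightOneSpectrum.natGenerator v = 3 :=
    congrArg Subtype.val
      ((Rat.HeightOneSpectrum.primesEquiv (R := ℤ)).apply_symm_apply ⟨3, Nat.prime_three⟩)
  have hvspan : v.asIdeal = Ideal.span {((3 : ℕ) : ℤ)} := by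
    rw [Rat.HeightOneSpectrum.asIdeal_eq_span_natGenerator_int, hv]
  haveI hlies' : 𝔓.asIdeal.LiesOver (Ideal.span {((3 : ℕ) : ℤ)}) :=
    Ideal.liesOver_span_of_natCast_mem' Nat.prime_three h3
  haveI hlies : 𝔓.asIdeal.LiesOver v.asIdeal := by rw [hvspan]; exact hlies'
  -- `e(𝔓|3) = 2`
  have hbot : v.asIdeal ≠ ⊥ := v.ne_bot
  have he : v.asIdeal.ramificationIdx' 𝔓.asIdeal = 2 := by
    rw [Ideal.ramificationIdx'_eq_ramificationIdx _ _ hbot]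
    exact IsCyclotomicExtension.Rat.ramificationIdx_eq_of_prime 3 K 𝔓.asIdeal
  -- `v`-adic valuation on `ℚ` is the `3`-adic one
  have hvq : v.valuation ℚ q = Rat.padicValuation 3 q := by
    by_cases hq : q = 0
    · rw [hq, map_zero, map_zero]
    · rw [Rat.HeightOneSpectrum.valuation_eq_exp_neg_padicValRat v hq, hv,
        padicValuation_three_apply hq]
  rw [valued_algebraMap_adicCompletion, ← valuation_liesOver (K := ℚ) (L := K) v 𝔓 q, he, hvq]

/-- **Extraction.** If `E_K` (`K = ℚ(ζ₃)`) has good reduction at the place `𝔓 ∣ 3`, then with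
`6 k = ord₃ Δ_min(E)` there is a RATIONAL `ρ`, `3`-integral, such that
`ord₃(b₂ + 12ρ) ≥ k`, `ord₃(b₄ + ρb₂ + 6ρ²) ≥ 2k`, `ord₃(b₆ + 2ρb₄ + ρ²b₂ + 4ρ³) ≥ 3k` (`b_i` the
`b`-invariants of the globally minimal `W`). The good `𝒪_𝔓`-model upstairs is
`(u, r, s, t) • W` with `v(u)¹² = v(Δ_W) = v₃(Δ_W)²`, so `v(u) = exp(−k)` with `6k = ord₃ Δ_W`, and
its `b`-invariants are integral (Silverman *AEC* III.1 Table 3.1, VII.1); the `3`-adic lift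
`ThreeAdicLift.exists_rat_of_integrality` replaces `r ∈ K_𝔓` by a rational `ρ`. -/
theorem exists_rat_of_hasGoodReductionAt_baseChange_three (𝔓 : HeightOneSpectrum (𝓞 K))
    (h3 : ((3 : ℕ) : 𝓞 K) ∈ 𝔓.asIdeal) (hgood : (W.baseChange K).HasGoodReductionAt 𝔓) :
    ∃ (k : ℕ) (ρ : ℚ), padicValInt 3 (minimalDiscriminantInt W) = 6 * k ∧
      Rat.padicValuation 3 ρ ≤ 1 ∧
      Rat.padicValuation 3 (W.b₂ + 12 * ρ) ≤ exp (-(k : ℤ)) ∧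
      Rat.padicValuation 3 (W.b₄ + ρ * W.b₂ + 6 * ρ ^ 2) ≤ exp (-(2 * k : ℤ)) ∧
      Rat.padicValuation 3 (W.b₆ + 2 * ρ * W.b₄ + ρ ^ 2 * W.b₂ + 4 * ρ ^ 3) ≤ exp (-(3 * k : ℤ)) := by
  set L := 𝔓.adicCompletion K with hLdef
  set ι : ℚ →+* L := (algebraMap K L).comp (algebraMap ℚ K) with hιdef
  have hι : ∀ q : ℚ, Valued.v (ι q) = Rat.padicValuation 3 q ^ 2 := fun q ↦
    valued_algebraMap_rat_eq_sq 𝔓 h3 q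
  -- the good model upstairs
  haveI : (W.baseChange K).IsElliptic := by rw [baseChange]; infer_instance
  obtain ⟨C, M, hCM, hMΔ⟩ := (W.baseChange K).exists_integralModel_of_hasGoodReductionAt hgood
  set X : WeierstrassCurve L := (W.baseChange K).baseChange L with hXdef
  have hXb₂ : X.b₂ = ι W.b₂ := by
    rw [hXdef, baseChange, map_b₂, baseChange, map_b₂, hιdef, RingHom.comp_apply]
  have hXb₄ : X.b₄ = ι W.b₄ := by
    rw [hXdef, baseChange, map_b₄, baseChange, map_b₄, hιdef, RingHom.comp_apply]
  have hXb₆ : X.b₆ = ι W.b₆ := by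
    rw [hXdef, baseChange, map_b₆, baseChange, map_b₆, hιdef, RingHom.comp_apply]
  have hXΔ : X.Δ = ι W.Δ := by
    rw [hXdef, baseChange, map_Δ, baseChange, map_Δ, hιdef, RingHom.comp_apply]
  have hint : ∀ m : 𝔓.adicCompletionIntegers K,
      Valued.v (algebraMap (𝔓.adicCompletionIntegers K) L m) ≤ 1 := fun m ↦
    (mem_adicCompletionIntegers (𝓞 K) K 𝔓).mp m.2
  have hCb₂ : Valued.v ((C • X).b₂) ≤ 1 := by rw [hCM, map_b₂]; exact hint _
  have hCb₄ : Valued.v ((C • X).b₄) ≤ 1 := by rw [hCM, map_b₄]; exact hint _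
  have hCb₆ : Valued.v ((C • X).b₆) ≤ 1 := by rw [hCM, map_b₆]; exact hint _
  have hCΔ : Valued.v ((C • X).Δ) = 1 := by
    rw [hCM, map_Δ]
    exact (Valuation.Integers.isUnit_iff_valuation_eq_one (Valuation.integer.integers _)).mp hMΔ
  have hu0 : (C.u : L) ≠ 0 := C.u.ne_zero
  -- `v(u)¹² = v(Δ_W) = v₃(Δ_W)²`
  have hΔ0 : W.Δ ≠ 0 := W.isUnit_Δ.ne_zero
  have hvu0 : Valued.v (C.u : L) ≠ 0 := (Valuation.ne_zero_iff _).mpr hu0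
  have hvXΔ : Valued.v X.Δ = Valued.v (C.u : L) ^ 12 := by
    rw [variableChange_Δ, Units.val_inv_eq_inv_val, map_mul, map_pow, map_inv₀] at hCΔ
    calc Valued.v X.Δ
        = Valued.v (C.u : L) ^ 12 * ((Valued.v (C.u : L))⁻¹ ^ 12 * Valued.v X.Δ) := by
          rw [← mul_assoc, ← mul_pow, mul_inv_cancel₀ hvu0, one_pow, one_mul]
      _ = Valued.v (C.u : L) ^ 12 := by rw [hCΔ, mul_one]
  have hvΔ : Valued.v (C.u : L) ^ 12 = Rat.padicValuation 3 W.Δ ^ 2 := by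
    rw [← hι, ← hXΔ, hvXΔ]
  -- `k` with `6k = ord₃ Δ_min` and `v(u) = exp(−k)`
  set n : ℕ := padicValInt 3 (minimalDiscriminantInt W) with hndef
  have hvΔ' : Rat.padicValuation 3 W.Δ = exp (-(n : ℤ)) := by
    rw [padicValuation_three_apply hΔ0, padicValRat_Δ_eq W 3]
  set a : ℤ := log (Valued.v (C.u : L)) with hadef
  have hua : Valued.v (C.u : L) = exp a := (exp_log hvu0).symm
  have h12 : 12 * a = -(2 * n : ℤ) := by
    rw [hua, hvΔ', ← exp_nsmul, ← exp_nsmul, exp_inj] at hvΔ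
    simp only [nsmul_eq_mul] at hvΔ
    push_cast at hvΔ
    linarith
  obtain ⟨k, hk⟩ : ∃ k : ℕ, (n : ℤ) = 6 * k ∧ a = -(k : ℤ) :=
    ⟨n / 6, by omega, by omega⟩
  have huk : Valued.v (C.u : L) = exp (-(k : ℤ)) := by rw [hua, hk.2]
  -- the three integrality conditions on `r = C.r`
  have hB₂ : Valued.v (ι W.b₂ + 12 * C.r) ≤ exp (-(2 * k : ℤ)) := by
    have h' : Valued.v ((C.u : L)⁻¹ ^ 2 * (ι W.b₂ + 12 * C.r)) ≤ 1 := by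
      rw [← hXb₂, ← Units.val_inv_eq_inv_val, ← variableChange_b₂]; exact hCb₂
    have h := valuation_le_pow_of_inv_pow_mul_le_one Valued.v hu0 h'
    rw [huk, ← exp_nsmul] at h
    convert h using 2; simp only [nsmul_eq_mul]; push_cast; ring
  have hB₄ : Valued.v (ι W.b₄ + C.r * ι W.b₂ + 6 * C.r ^ 2) ≤ exp (-(4 * k : ℤ)) := by
    have h' : Valued.v ((C.u : L)⁻¹ ^ 4 * (ι W.b₄ + C.r * ι W.b₂ + 6 * C.r ^ 2)) ≤ 1 := by
      rw [← hXb₂, ← hXb₄, ← Units.val_inv_eq_inv_val, ← variableChange_b₄]; exact hCb₄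
    have h := valuation_le_pow_of_inv_pow_mul_le_one Valued.v hu0 h'
    rw [huk, ← exp_nsmul] at h
    convert h using 2; simp only [nsmul_eq_mul]; push_cast; ring
  have hB₆ : Valued.v (ι W.b₆ + 2 * C.r * ι W.b₄ + C.r ^ 2 * ι W.b₂ + 4 * C.r ^ 3) ≤
      exp (-(6 * k : ℤ)) := by
    have h' : Valued.v ((C.u : L)⁻¹ ^ 6 *
        (ι W.b₆ + 2 * C.r * ι W.b₄ + C.r ^ 2 * ι W.b₂ + 4 * C.r ^ 3)) ≤ 1 := by
      rw [← hXb₂, ← hXb₄, ← hXb₆, ← Units.val_inv_eq_inv_val, ← variableChange_b₆]; exact hCb₆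
    have h := valuation_le_pow_of_inv_pow_mul_le_one Valued.v hu0 h'
    rw [huk, ← exp_nsmul] at h
    convert h using 2; simp only [nsmul_eq_mul]; push_cast; ring
  -- the `3`-adic lift
  obtain ⟨hb₂, hb₄, hb₆⟩ := padicValuation_b_le_one W
  have hres : ∀ x : L, Valued.v x ≤ 1 → ∃ c : ℤ, Valued.v (x - ι c) < 1 := fun x hx ↦ by
    obtain ⟨c, hc⟩ := exists_int_valued_sub_lt_one 𝔓 h3 x hx
    exact ⟨c, by rwa [map_intCast]⟩
  obtain ⟨ρ, hρ, h₂, h₄, h₆⟩ := ThreeAdicLift.exists_rat_of_integrality Valued.v ι (Rat.padicValuation 3)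
    hι (Rat.padicValuation_self 3) (by rw [show (2 : ℚ) = ((2 : ℤ) : ℚ) by norm_num,
      Rat.padicValuation_cast, Int.padicValuation_eq_one_iff]; decide)
    (fun c ↦ by rw [Rat.padicValuation_cast]; exact Int.padicValuation_le_one 3 c)
    hres hb₂ hb₄ hb₆ hB₂ hB₄ hB₆
  exact ⟨k, ρ, by exact_mod_cast hk.1, hρ, h₂, h₄, h₆⟩

end Extraction

/-! ### The place of `ℚ` at `3`: `3`-adic readings -/

section PlaceThree

/-- At the place `u ∋ 3` of `ℚ`: `u(x) ≤ 1 ↔ v₃(x) ≤ 1` (Mathlib `valuation_equiv_padicValuation`). [folklore] -/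
theorem valuation_le_one_iff_padicValuation_three (u : HeightOneSpectrum (𝓞 ℚ))
    (hu : ((3 : ℕ) : 𝓞 ℚ) ∈ u.asIdeal) (x : ℚ) :
    u.valuation ℚ x ≤ 1 ↔ Rat.padicValuation 3 x ≤ 1 := by
  haveI : Fact (Nat.Prime ((Rat.HeightOneSpectrum.primesEquiv u : Nat.Primes) : ℕ)) :=
    ⟨(Rat.HeightOneSpectrum.primesEquiv u).2⟩
  have hq : ((Rat.HeightOneSpectrum.primesEquiv u : Nat.Primes) : ℕ) = 3 :=
    Rat.HeightOneSpectrum.primesEquiv_eq_of_natCast_mem u Nat.prime_three hu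
  have hequiv := Rat.HeightOneSpectrum.valuation_equiv_padicValuation u
  rw [Valuation.isEquiv_iff_val_le_one] at hequiv
  rw [hequiv]
  by_cases hx : x = 0
  · simp [hx]
  rw [padicValuation_apply_of_ne_zero _ hx, padicValuation_three_apply hx, hq]

/-- At the place `u ∋ 3` of `ℚ`: `u(x) = 1 ↔ v₃(x) = 1`. [folklore] -/
theorem valuation_eq_one_iff_padicValuation_three (u : HeightOneSpectrum (𝓞 ℚ))
    (hu : ((3 : ℕ) : 𝓞 ℚ) ∈ u.asIdeal) (x : ℚ) :
    u.valuation ℚ x = 1 ↔ Rat.padicValuation 3 x = 1 := by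
  haveI : Fact (Nat.Prime ((Rat.HeightOneSpectrum.primesEquiv u : Nat.Primes) : ℕ)) :=
    ⟨(Rat.HeightOneSpectrum.primesEquiv u).2⟩
  have hq : ((Rat.HeightOneSpectrum.primesEquiv u : Nat.Primes) : ℕ) = 3 :=
    Rat.HeightOneSpectrum.primesEquiv_eq_of_natCast_mem u Nat.prime_three hu
  have hequiv := Rat.HeightOneSpectrum.valuation_equiv_padicValuation u
  rw [hequiv.eq_one_iff_eq_one]
  by_cases hx : x = 0
  · simp [hx]
  rw [padicValuation_apply_of_ne_zero _ hx, padicValuation_three_apply hx, hq]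

/-- `v₃(x / (3ʲ m)) ≤ 1` when `v₃(x) ≤ exp(−j)` and `3 ∤ m`. [folklore] -/
theorem padicValuation_three_div_le_one {x : ℚ} {j : ℕ} {m : ℤ} (hm : ¬ (3 : ℤ) ∣ m)
    (hx : Rat.padicValuation 3 x ≤ exp (-(j : ℤ))) :
    Rat.padicValuation 3 (x / (3 ^ j * m)) ≤ 1 := by
  have hm1 : Rat.padicValuation 3 (m : ℚ) = 1 := by
    rw [Rat.padicValuation_cast, Int.padicValuation_eq_one_iff]; exact_mod_cast hm
  have h3j : Rat.padicValuation 3 ((3 : ℚ) ^ j) = exp (-(j : ℤ)) := by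
    rw [map_pow, show (3 : ℚ) = ((3 : ℕ) : ℚ) by norm_num, Rat.padicValuation_self, ← exp_nsmul]
    simp
  rw [map_div₀, map_mul, hm1, mul_one, h3j]
  exact div_le_one_of_le₀ hx zero_le

/-- `v₃(x / (3ʲ m)) = 1` when `v₃(x) = exp(−j)` and `3 ∤ m`. [folklore] -/
theorem padicValuation_three_div_eq_one {x : ℚ} {j : ℕ} {m : ℤ} (hm : ¬ (3 : ℤ) ∣ m)
    (hx : Rat.padicValuation 3 x = exp (-(j : ℤ))) :
    Rat.padicValuation 3 (x / (3 ^ j * m)) = 1 := by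
  have hm1 : Rat.padicValuation 3 (m : ℚ) = 1 := by
    rw [Rat.padicValuation_cast, Int.padicValuation_eq_one_iff]; exact_mod_cast hm
  have h3j : Rat.padicValuation 3 ((3 : ℚ) ^ j) = exp (-(j : ℤ)) := by
    rw [map_pow, show (3 : ℚ) = ((3 : ℕ) : ℚ) by norm_num, Rat.padicValuation_self, ← exp_nsmul]
    simp
  rw [map_div₀, map_mul, hm1, mul_one, h3j, hx, div_self exp_ne_zero]

end PlaceThree

end Summit.BirchSwinnertonDyer.Rank1Residual.Additive

end
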